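import Summits.BirchSwinnertonDyer.BirchSwinnertonDyer.Theorems.AlignedTransportAtTwoMainConjectureOfRankZeroBSDAtTwoNarrowCubicNamedInputDyadic
import Literature.NumberTheory.CubicFields.CubicFieldDiscriminantSquareClassInClosure
import HarnessLib

/-!
# Route `AlignedTransportAtTwo`, crux C2 `MainConjectureOfRankZeroBSDAtTwo` (stmt-BirchSwinnertonDyer-22298):
# THE CUBIC `2`-TORSION FIELD AND THE CURVE HAVE THE SAME DISCRIMINANT SQUARE CLASS — `d_F = Δ_W · b²` (`b ∈ ℚˣ`); hence
# `v_p(d_F) ≡ v_p(Δ_min) (mod 2)` at every prime, good reduction at `2` ⟹ `v₂(d_F)` EVEN, and the DYADIC named input sharpens once more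

HONEST FRAMING. WIDTH-5 attached prover seat `bsd-line-att-p4` g34 on line `birth` of the lead `bsd-line-att-p2` (WAKE-only); `--supports`
stmt-BirchSwinnertonDyer-22298, closes nothing; BSD is NOT proved; crux C2, its verdict «blocked-on `Rank1Residual.GreenbergMuConjectureIrreducible`»
and every registered stub (P / T / Kμ / LimDoor / MuIneqʳ / PFμ⁺ of `Lines/birth.lean` v9) untouched. THEOREMS ONLY (no `def`, no named fact, no `sorry`).
Sequel of this seat's `…NarrowCubicNamedInputDyadic` (C2 from narrow `μ₂⁺ = 0` on the non-cyclic cubic fields that embed into `ℚ₂`) and of the W-free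
Literature lemma `CubicFields/CubicFieldDiscriminantSquareClassInClosure` (the rational square classes that die in the Galois closure of an `S₃`-cubic
`F` are exactly `{1, d_F}`).

* §1 ★★ `exists_discr_eq_Δ_mul_sq` — **for every elliptic curve `W/ℚ` with `W(ℚ)[2] = 0` and `Δ_W ∉ ℚ²` and every cubic number field `F` containing a
  root of the `u`-cubic `c_W`: `d_F = Δ_W · b²` for some rational `b ≠ 0`** (W-free target `F`; the cubic `c_W` splits in the Galois sextic closure `N`
  of `F`, so `256·Δ_W = disc c_W` is a square there — att-p4 g11 `…KilfordStratum.isSquare_ratCast_Δ_of_splits_map`; then the Literature lemma).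
  So the quadratic resolvent of the cubic `2`-torsion field is `ℚ(√Δ_W)` in the strong form «same square class», not only «same field».
* §2 ★ `even_padicValInt_discr_iff` (`W` globally minimal, any prime `p`): **`v_p(d_F)` is even ⟺ `v_p(Δ_min)` is even**;
  ★ `even_padicValInt_two_discr_of_isOrdinaryAt` / `…_of_hasGoodReductionAtPrime` — **good reduction at `2` ⟹ `v₂(d_F)` EVEN** (so `v₂(d_F) ∈ {0, 2}`
  by Hasse's bound `v₂ ≤ 3` for cubic fields; the cubic fields with `8 ∥ d_F`, e.g. `ℚ[x]/(x³ − x − 2)` of discriminant `−104`, embed into `ℚ₂` but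
  are the `2`-torsion field of NO curve with good reduction at `2`); `dvd_discr_of_odd_padicValInt_minimalDiscriminantInt` — **a prime at which the
  minimal discriminant has ODD valuation ramifies in the cubic `2`-torsion field**; `discr_pos_iff_Δ_pos` (same sign; g33 had it via Brill + real roots).
* §3 ★★★ `crux_of_forall_dyadic_evenDiscr_nonGalois_cubicField_narrowClassicalMu` — **«narrow `μ₂⁺ = 0` for every non-cyclic cubic number field `F`
  with `F ↪ ℚ₂` AND `v₂(d_F)` even» + PRINT⁵ + MuIneqʳ ⟹ `MainConjectureOfRankZeroBSDAtTwo` BY NAME** — the weakest W-free field class the cell has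
  isolated so far (RESTATEMENT MENU: `NarrowMuTwoOfDyadicEvenDiscNonCyclicCubic`); `narrowMu_dyadicEven_of_narrowMu_dyadic` (bookkeeping).
* §4 (appended) ★★ `pointFieldMuCyc_of_forall_dyadic_evenDiscr_nonGalois_cubicField_narrowClassicalMu` — the REGISTERED STUB PFμ⁺ (`PointFieldMuCycAtTwo`, body
  verbatim) from the dyadic-even input (for the v13 skeleton proposal `Lines/birth_v13_proposal_att_p4g34.lean`).

The hypotheses of §3 are OPEN instances of Iwasawa's `μ`-conjecture / Greenberg–Kida; nothing is asserted about them. Expected REF2 grades: §1–§2 TEXTBOOK /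
FOLKLORE (`ℚ(√d_F) = ℚ(√Δ)` is classical — e.g. the `2`-division field is `F(√Δ)`), §3 COROLLARY-OF-TREE. PARTITION: none; beyond-print theorem: no; BSD is
NOT proved by any of this.

References: [SilvermanAEC2009] III.§1 (`b₂, b₄, b₆`, `Δ`; the `2`-division polynomial), VII.5 Prop. 5.1 (good reduction ⟺ `v(Δ_min) = 0`); [Marcus2018] Ch. 2;
[Cohen1993] §6.3.3; [Kida1982JFields] Thm. 1, Remark (ii); [Greenberg2001IwasawaPastPresent] §4; [Kato2004Asterisque] Thm. 17.4, §17.13; [GreenbergLNM1716]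
Thm. 4.1, Conj. 1.11; tree: this seat `…NarrowCubicNamedInputDyadic`, g33 `…NarrowCubicNamedInput` / `CubicFields/CubicFieldGaloisIffSquareDiscriminant`,
att-p4 g11 `…KilfordStratum`, att-p5 g14 `…AlignedTransportAtTwoBridge`, `Literature/…/EllipticCurves/GlobalMinimalModel` (`cast_minimalDiscriminantInt`).
-/

-- the Theorems namespace of this sub repeats the summit name by design (D-0017 nested layout)
set_option linter.dupNamespace false
set_option autoImplicit false

noncomputable section

open scoped NumberField IntermediateField

namespace Summit.BirchSwinnertonDyer.BirchSwinnertonDyer.Theorems.AlignedTransportAtTwoCubicDiscriminantSquareClass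

open NumberField Polynomial WeierstrassCurve IntermediateField Field CongruenceSubgroup IsDedekindDomain
  Literature.NumberTheory.EllipticCurves Literature.NumberTheory.EllipticCurves.Greenberg1999
  Literature.NumberTheory.EllipticCurves.ModularForms Literature.NumberTheory.EllipticCurves.Rank1Residual
  Literature.NumberTheory.EllipticCurves.Module
  Literature.NumberTheory.EllipticCurves.DokchitserDokchitser2012
  Literature.NumberTheory.EllipticCurves.ZpExtension Literature.NumberTheory.GaloisRepresentations
  Literature.NumberTheory.IwasawaTheory Literature.NumberTheory.NumberFields Literature.NumberTheory.CubicFields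
  Summit.BirchSwinnertonDyer.Rank1Residual Summit.BirchSwinnertonDyer.Rank1Residual.X1.MuLambda
  Summit.BirchSwinnertonDyer.Rank1Residual.X5 Summit.BirchSwinnertonDyer.Rank1Residual.F1Sign2
  Summit.BirchSwinnertonDyer.BirchSwinnertonDyer.Theorems.Rank1ResidualX1Defs
  Summit.BirchSwinnertonDyer.BirchSwinnertonDyer.Theses.AlignedTransportAtTwo
  Summit.BirchSwinnertonDyer.BirchSwinnertonDyer.Theorems.AlignedTransportAtTwoNarrowCubicNamedInput
  Summit.BirchSwinnertonDyer.BirchSwinnertonDyer.Theorems.AlignedTransportAtTwoNarrowCubicNamedInputDyadic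
  Summit.BirchSwinnertonDyer.BirchSwinnertonDyer.Theorems.AlignedTransportAtTwoBridge
  Summit.BirchSwinnertonDyer.BirchSwinnertonDyer.Theorems.AlignedTransportAtTwoKilfordStratum

/-! ## §1 `d_F = Δ_W · b²` -/

section SquareClass

variable (W : WeierstrassCurve ℚ) [W.IsElliptic]

/-- ★★ **THE CUBIC `2`-TORSION FIELD AND THE CURVE HAVE THE SAME DISCRIMINANT SQUARE CLASS**: for `W/ℚ` elliptic with `W(ℚ)[2] = 0` and `Δ_W ∉ ℚ²`,
and every cubic number field `F` containing a root `e` of the `u`-cubic `c_W`: `d_F = Δ_W·b²` with `b ∈ ℚ`, `b ≠ 0`. (In the Galois sextic closure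
`N ⊇ ι(F)` the irreducible `c_W = minpoly(ι e)` splits, so `Δ_W = disc(c_W)/256` is a square in `N`; the rational square classes dying in `N` are
`{1, d_F}` and `Δ_W ∉ ℚ²`.) [cite: SilvermanAEC2009, III.§1 (Δ and the 2-division polynomial)] [cite: Marcus2018, Ch. 2 (discriminants and embeddings)]
[cite: Cohen1993, §6.3.3] -/
theorem exists_discr_eq_Δ_mul_sq (ht : ∀ x : ℚ, ¬ HasRationalTwoTorsionX W x) (hsq : ¬ IsSquare W.Δ)
    {F : Type} [Field F] [NumberField F] (hF : Module.finrank ℚ F = 3) {e : F} (he : aeval e (twoDivisionUCubic W) = 0) :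
    ∃ b : ℚ, b ≠ 0 ∧ (NumberField.discr F : ℚ) = W.Δ * b ^ 2 := by
  have hFG : ¬ IsGalois ℚ F := not_isGalois_of_root W ht hsq hF he
  obtain ⟨N, _, hGal, h6, ⟨ι⟩, -, -⟩ := exists_galoisClosure_of_not_isGalois_cubic F hF hFG
  haveI := hGal
  haveI : NumberField ↥N := NumberField.mk
  -- `c_W = minpoly (ι e)` splits in the normal field `N`
  have hιe : aeval (ι e) (twoDivisionUCubic W) = 0 := by rw [aeval_algHom_apply, he, map_zero]
  have hmin : minpoly ℚ (ι e) = twoDivisionUCubic W := minpoly_eq_twoDivisionUCubic W ht hιe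
  have hspl : ((twoDivisionUCubic W).map (algebraMap ℚ ↥N)).Splits := by
    rw [← hmin]; exact Normal.splits inferInstance (ι e)
  obtain ⟨r, hr⟩ := isSquare_ratCast_Δ_of_splits_map W hspl
  have hx : r ^ 2 = algebraMap ℚ ↥N W.Δ := by rw [eq_ratCast, sq, ← hr]
  exact discr_eq_mul_sq_of_sq_eq ↥N h6 hF hFG ι hsq hx

/-- **Same sign**: `d_F > 0 ⟺ Δ_W > 0` (W-free target `F`; g33 `…NarrowCubicNamedInputSignSplit` had it through Brill and the real roots).
[cite: SilvermanAEC2009, III.§1] [cite: Cohen1993, Prop. 4.8.11 and §6.3.3] -/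
theorem discr_pos_iff_Δ_pos (ht : ∀ x : ℚ, ¬ HasRationalTwoTorsionX W x) (hsq : ¬ IsSquare W.Δ)
    {F : Type} [Field F] [NumberField F] (hF : Module.finrank ℚ F = 3) {e : F} (he : aeval e (twoDivisionUCubic W) = 0) :
    0 < NumberField.discr F ↔ 0 < W.Δ := by
  obtain ⟨b, hb, h⟩ := exists_discr_eq_Δ_mul_sq W ht hsq hF he
  have hb2 : (0 : ℚ) < b ^ 2 := by positivity
  rw [← Int.cast_pos (R := ℚ), h]
  constructor
  · intro hpos
    by_contra hle
    have : W.Δ * b ^ 2 ≤ 0 := mul_nonpos_of_nonpos_of_nonneg (not_lt.mp hle) hb2.le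
    linarith
  · intro hpos
    positivity

end SquareClass

/-! ## §2 Valuation parity: `v_p(d_F) ≡ v_p(Δ_min) (mod 2)`; good reduction at `2` ⟹ `v₂(d_F)` even -/

section Parity

variable (W : WeierstrassCurve ℚ) [W.IsElliptic] [W.IsGloballyMinimal]

/-- The valuation identity `v_p(d_F) = v_p(Δ_min) + 2·v_p(b)` behind the parity law. [cite: SilvermanAEC2009, VII.§1 (minimal discriminant)]
[cite: Marcus2018, Ch. 2] -/
theorem padicValInt_discr_eq (ht : ∀ x : ℚ, ¬ HasRationalTwoTorsionX W x) (hsq : ¬ IsSquare W.Δ)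
    {F : Type} [Field F] [NumberField F] (hF : Module.finrank ℚ F = 3) {e : F} (he : aeval e (twoDivisionUCubic W) = 0)
    (p : ℕ) [Fact p.Prime] :
    ∃ b : ℚ, b ≠ 0 ∧ (padicValInt p (NumberField.discr F) : ℤ) = padicValInt p (minimalDiscriminantInt W) + 2 * padicValRat p b := by
  obtain ⟨b, hb, h⟩ := exists_discr_eq_Δ_mul_sq W ht hsq hF he
  refine ⟨b, hb, ?_⟩
  have hΔ : (minimalDiscriminantInt W : ℚ) ≠ 0 := by
    rw [cast_minimalDiscriminantInt]; exact W.isUnit_Δ.ne_zero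
  have hval : padicValRat p ((NumberField.discr F : ℤ) : ℚ) =
      padicValRat p ((minimalDiscriminantInt W : ℤ) : ℚ) + 2 * padicValRat p b := by
    rw [h, ← cast_minimalDiscriminantInt, padicValRat.mul hΔ (pow_ne_zero 2 hb), padicValRat.pow b]
    push_cast
    ring
  rwa [padicValRat.of_int, padicValRat.of_int] at hval

/-- ★ **`v_p(d_F)` is even ⟺ `v_p(Δ_min)` is even**, for every prime `p` (`W` globally minimal, `W(ℚ)[2] = 0`, `Δ ∉ ℚ²`, `F` any cubic field with a root of
`c_W`). [cite: SilvermanAEC2009, VII.§1 (minimal discriminant)] [cite: Marcus2018, Ch. 2 (discriminants)] -/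
theorem even_padicValInt_discr_iff (ht : ∀ x : ℚ, ¬ HasRationalTwoTorsionX W x) (hsq : ¬ IsSquare W.Δ)
    {F : Type} [Field F] [NumberField F] (hF : Module.finrank ℚ F = 3) {e : F} (he : aeval e (twoDivisionUCubic W) = 0)
    (p : ℕ) [Fact p.Prime] :
    Even (padicValInt p (NumberField.discr F)) ↔ Even (padicValInt p (minimalDiscriminantInt W)) := by
  obtain ⟨b, -, h⟩ := padicValInt_discr_eq W ht hsq hF he p
  have h2 : Even (2 * padicValRat p b) := even_two_mul _
  rw [← Int.even_coe_nat, ← Int.even_coe_nat, h, Int.even_add]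
  exact ⟨fun hh ↦ hh.mpr h2, fun hm ↦ ⟨fun _ ↦ h2, fun _ ↦ hm⟩⟩

/-- ★ **Good reduction at `2` ⟹ `v₂(d_F)` is EVEN** for every cubic number field `F` containing a root of `c_W` (`W` globally minimal, `W(ℚ)[2] = 0`,
`Δ_W ∉ ℚ²`): `2 ∤ Δ_min`. With Hasse's bound `v₂(d_F) ≤ 3` for cubic fields this says `v₂(d_F) ∈ {0, 2}`: the cubic fields with `8 ∥ d_F` are the
`2`-torsion field of no curve with good reduction at `2`. [cite: SilvermanAEC2009, VII.5 Prop. 5.1 (good reduction iff v(Δ_min) = 0)] [cite: Marcus2018, Ch. 2] -/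
theorem even_padicValInt_two_discr_of_hasGoodReductionAtPrime (hgood : W.HasGoodReductionAtPrime 2)
    (ht : ∀ x : ℚ, ¬ HasRationalTwoTorsionX W x) (hsq : ¬ IsSquare W.Δ)
    {F : Type} [Field F] [NumberField F] (hF : Module.finrank ℚ F = 3) {e : F} (he : aeval e (twoDivisionUCubic W) = 0) :
    Even (padicValInt 2 (NumberField.discr F)) := by
  haveI : Fact (Nat.Prime 2) := ⟨Nat.prime_two⟩
  rw [even_padicValInt_discr_iff W ht hsq hF he 2,
    padicValInt.eq_zero_of_not_dvd (not_dvd_minimalDiscriminantInt_of_hasGoodReductionAtPrime' W 2 hgood)]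
  exact Even.zero

/-- ★ **Good ORDINARY reduction at `2` ⟹ `v₂(d_F)` is even** (the cell's hypothesis `IsOrdinaryAt W 2`). [cite: SilvermanAEC2009, VII.5 Prop. 5.1] [cite: Marcus2018, Ch. 2] -/
theorem even_padicValInt_two_discr_of_isOrdinaryAt (hord : IsOrdinaryAt W 2)
    (ht : ∀ x : ℚ, ¬ HasRationalTwoTorsionX W x) (hsq : ¬ IsSquare W.Δ)
    {F : Type} [Field F] [NumberField F] (hF : Module.finrank ℚ F = 3) {e : F} (he : aeval e (twoDivisionUCubic W) = 0) :
    Even (padicValInt 2 (NumberField.discr F)) :=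
  even_padicValInt_two_discr_of_hasGoodReductionAtPrime W ((isOrdinaryAt_iff W 2).mp hord).1 ht hsq hF he

/-- **A prime at which the minimal discriminant has ODD valuation RAMIFIES in the cubic `2`-torsion field** (`p ∣ d_F`; e.g. multiplicative reduction of
type `I_{2k+1}`). [cite: SilvermanAEC2009, VII.§1 and C.15 (Tate curve: `ℚ_p(E[2]) ∋ √Δ`)] [cite: Marcus2018, Ch. 2 and Ch. 3 (p ramifies iff p ∣ d_F)] -/
theorem dvd_discr_of_odd_padicValInt_minimalDiscriminantInt (ht : ∀ x : ℚ, ¬ HasRationalTwoTorsionX W x) (hsq : ¬ IsSquare W.Δ)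
    {F : Type} [Field F] [NumberField F] (hF : Module.finrank ℚ F = 3) {e : F} (he : aeval e (twoDivisionUCubic W) = 0)
    (p : ℕ) [Fact p.Prime] (hodd : Odd (padicValInt p (minimalDiscriminantInt W))) :
    (p : ℤ) ∣ NumberField.discr F := by
  have hne : ¬ Even (padicValInt p (NumberField.discr F)) := by
    rw [even_padicValInt_discr_iff W ht hsq hF he p]; exact Nat.not_even_iff_odd.mpr hodd
  have hpos : padicValInt p (NumberField.discr F) ≠ 0 := fun h0 ↦ hne (by rw [h0]; exact Even.zero)
  by_contra hnd
  exact hpos (padicValInt.eq_zero_of_not_dvd hnd)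

end Parity

/-! ## §3 The DYADIC named input, sharpened by the parity of `v₂(d_F)` -/

section Cell

/-- ★★★ **«NARROW `μ₂⁺ = 0` FOR EVERY NON-CYCLIC CUBIC NUMBER FIELD WITH `F ↪ ℚ₂` AND `v₂(d_F)` EVEN» + PRINT⁵ + MuIneqʳ ⟹ C2 BY NAME.** Granted PRINT
{Kato 17.4 (1)(2) at `2` (every curve), Greenberg 4.1, period unit, modularity, GZK} and the registered stub MuIneqʳ (`hI`): IF for every cubic number field
`F`, not Galois over `ℚ`, admitting a ring map `F → ℚ₂`, whose discriminant has EVEN `2`-adic valuation, (a) every cyclotomic `ℤ₂`-extension of `F` has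
`μ = 0` (growth form) and (b) the narrow `2`-defect is bounded along them, THEN `MainConjectureOfRankZeroBSDAtTwo`. For each `W` the hypothesis is used
once on a cubic `F ∋ e`, `c_W(e) = 0`: not Galois (g33), dyadic (`…NarrowCubicNamedInputDyadic`), `v₂(d_F)` even (§2). OPEN IN PRINT on both conjuncts;
nothing is asserted about the hypothesis. CONDITIONAL; the item stays open; BSD is NOT proved. [cite: Greenberg2001IwasawaPastPresent, §4 (Iwasawa's μ = 0 conjecture)]
[cite: Kida1982JFields, Thm. 1 (p. 340) and Remark (ii) (p. 341)] [cite: Kato2004Asterisque, Thm. 17.4 (p. 273) and §17.13 (pp. 279–280)]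
[cite: GreenbergLNM1716, Thm. 4.1 (p. 102) and Conj. 1.11 (p. 58)] -/
theorem crux_of_forall_dyadic_evenDiscr_nonGalois_cubicField_narrowClassicalMu
    (h17 : ∀ (V : WeierstrassCurve ℚ) [V.IsElliptic] [V.IsGloballyMinimal] [NeZero (V.conductorNorm ℤ)]
      (f : CuspForm (Gamma0 (V.conductorNorm ℤ)) 2), kato_divisibility_allPrimes V 2 (f := f))
    (hGr : Greenberg1999.thm41_charValue_rankZero_anyPrime)
    (hper : realPeriodRat_eq_unit_mul_plusPeriod_two) (hmod : nonempty_modularParametrizationData)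
    (hGZK : rank_eq_analyticRank_of_analyticRank_le_one)
    (hI : ∀ (W : WeierstrassCurve ℚ) [W.IsElliptic] [W.IsGloballyMinimal], IsOrdinaryAt W 2 →
      (∀ x : ℚ, ¬ HasRationalTwoTorsionX W x) →
      ∀ (κ : ZpExtension ℚ 2) (γ : Field.absoluteGaloisGroup ℚ), κ.IsCyclotomic →
      κ.IsTopGenerator γ → IsCyclotomicVariable 2 γ →
      ∀ ⦃N : ℕ⦄ [NeZero N] (f : CuspForm (Gamma0 N) 2), IsNewformOf W f →
      ∀ Gp : IwasawaAlgebra 2, iwasawaToPowerSeries 2 Gp = padicLFunction f (unitRoot W 2 : ℚ_[2]) →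
      ∀ (D : W.SelmerDualData κ γ) (Yr : W.FineSelmerDualDataRelaxedInf κ γ),
        lengthAt (IwasawaAlgebra 2) D.X ⟨IwasawaAlgebra.augIdealP 2, IwasawaAlgebra.isPrime_augIdealP_holds 2⟩ ≤
          lengthAt (IwasawaAlgebra 2) (IwasawaAlgebra 2 ⧸ Ideal.span {Gp})
              ⟨IwasawaAlgebra.augIdealP 2, IwasawaAlgebra.isPrime_augIdealP_holds 2⟩ +
            lengthAt (IwasawaAlgebra 2) Yr.X ⟨IwasawaAlgebra.augIdealP 2, IwasawaAlgebra.isPrime_augIdealP_holds 2⟩)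
    (hN : ∀ (F : Type) [Field F] [NumberField F], Module.finrank ℚ F = 3 → ¬ IsGalois ℚ F → Nonempty (F →+* ℚ_[2]) →
      Even (padicValInt 2 (NumberField.discr F)) →
      (∀ κ : ZpExtension F 2, κ.IsCyclotomic → ClassicalMuVanishes κ) ∧
        ∃ D : ℕ, ∀ κ : ZpExtension F 2, κ.IsCyclotomic → ∀ n : ℕ, ∀ [NumberField ↥(κ.layer n)],
          padicValNat 2 (narrowClassNumber ↥(κ.layer n)) ≤ padicValNat 2 (classNumber ↥(κ.layer n)) + D) :
    MainConjectureOfRankZeroBSDAtTwo :=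
  crux_of_forall_cubicField_root_narrowClassicalMu h17 hGr hper hmod hGZK hI
    (fun W _ _ _ hord ht hsq _ _ F _ _ hF _ he ↦
      hN F hF (not_isGalois_of_root W ht hsq hF he) (nonempty_ringHom_padic_two_of_root W hord ht hF he)
        (even_padicValInt_two_discr_of_isOrdinaryAt W hord ht hsq hF he))

/-- **The dyadic binder ⟹ the dyadic-even binder** (forget the parity clause): every certificate / filing made for `…NarrowCubicNamedInputDyadic`'s input
serves this one verbatim. [cite: Kida1982JFields, Remark (ii) (p. 341)] -/
theorem narrowMu_dyadicEven_of_narrowMu_dyadic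
    (hN : ∀ (F : Type) [Field F] [NumberField F], Module.finrank ℚ F = 3 → ¬ IsGalois ℚ F → Nonempty (F →+* ℚ_[2]) →
      (∀ κ : ZpExtension F 2, κ.IsCyclotomic → ClassicalMuVanishes κ) ∧
        ∃ D : ℕ, ∀ κ : ZpExtension F 2, κ.IsCyclotomic → ∀ n : ℕ, ∀ [NumberField ↥(κ.layer n)],
          padicValNat 2 (narrowClassNumber ↥(κ.layer n)) ≤ padicValNat 2 (classNumber ↥(κ.layer n)) + D) :
    ∀ (F : Type) [Field F] [NumberField F], Module.finrank ℚ F = 3 → ¬ IsGalois ℚ F → Nonempty (F →+* ℚ_[2]) →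
      Even (padicValInt 2 (NumberField.discr F)) →
      (∀ κ : ZpExtension F 2, κ.IsCyclotomic → ClassicalMuVanishes κ) ∧
        ∃ D : ℕ, ∀ κ : ZpExtension F 2, κ.IsCyclotomic → ∀ n : ℕ, ∀ [NumberField ↥(κ.layer n)],
          padicValNat 2 (narrowClassNumber ↥(κ.layer n)) ≤ padicValNat 2 (classNumber ↥(κ.layer n)) + D :=
  fun F _ _ hF hG hσ _ ↦ hN F hF hG hσ

end Cell

/-! ## §4 (appended, same gen) The registered stub PFμ⁺ from the dyadic-even input -/

section Stub

open Summit.BirchSwinnertonDyer.BirchSwinnertonDyer.Theorems.AlignedTransportAtTwoFineRoad.DivisionCubic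
  Summit.BirchSwinnertonDyer.BirchSwinnertonDyer.Theorems.AlignedTransportAtTwoPointFieldCarrierCM
  Summit.BirchSwinnertonDyer.BirchSwinnertonDyer.Theorems.AlignedTransportAtTwoPointFieldCarrierCMIff
  Summit.BirchSwinnertonDyer.BirchSwinnertonDyer.Theorems.AlignedTransportAtTwoCMSexticFieldDoor
  Summit.BirchSwinnertonDyer.BirchSwinnertonDyer.Theorems.AlignedTransportAtTwoSharedCubicDivisionField

/-- ★★ **THE REGISTERED STUB PFμ⁺ (`PointFieldMuCycAtTwo`, body verbatim) FROM THE DYADIC-EVEN NAMED INPUT.** «∀ non-Galois cubic `F` with `F ↪ ℚ₂` and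
`v₂(d_F)` even: `μ₂(F^cyc) = 0` ∧ bounded narrow `2`-defect» ⟹ for every seed-cell `W` (binders of the stub verbatim) and every `i² = −1`: `μ₂ = 0` for every
cyclotomic `ℤ₂`-extension of `ℚ(W[2]) ⊔ ℚ⟮i⟯`. On the model `ℚ⟮β₀⟯ ∋ 4β₀` (a root of `c_W`): not Galois (g33), dyadic (`…NarrowCubicNamedInputDyadic`), `v₂(d)` even
(§2); then cell `bsd-2adic`'s Kida-lite ascent and att-p3 g34's ascent to `ℚ(W[2], i)`. With this a v13 skeleton (road (b″): P, LimDoor, MuIneqʳ, PFμ⁺ ⟹ T ⟹ C2)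
is sorry-free MODULO {PRINT⁵, LimDoor, MuIneqʳ} and ONE named conjecture on the dyadic-even class. CONDITIONAL; nothing closed; BSD is NOT proved.
[cite: Kida1982JFields, Thm. 1 (p. 340)] [cite: Iwasawa1973MuInvariants, Thm. 2 and Thm. 3, §3–§4] [cite: Greenberg2001IwasawaPastPresent, §4] -/
theorem pointFieldMuCyc_of_forall_dyadic_evenDiscr_nonGalois_cubicField_narrowClassicalMu
    (hN : ∀ (F : Type) [Field F] [NumberField F], Module.finrank ℚ F = 3 → ¬ IsGalois ℚ F → Nonempty (F →+* ℚ_[2]) →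
      Even (padicValInt 2 (NumberField.discr F)) →
      (∀ κ : ZpExtension F 2, κ.IsCyclotomic → ClassicalMuVanishes κ) ∧
        ∃ D : ℕ, ∀ κ : ZpExtension F 2, κ.IsCyclotomic → ∀ n : ℕ, ∀ [NumberField ↥(κ.layer n)],
          padicValNat 2 (narrowClassNumber ↥(κ.layer n)) ≤ padicValNat 2 (classNumber ↥(κ.layer n)) + D) :
    ∀ (W : WeierstrassCurve ℚ) [W.IsElliptic] [W.IsGloballyMinimal], ¬ W.HasCM →
      IsOrdinaryAt W 2 → (∀ x : ℚ, ¬ HasRationalTwoTorsionX W x) → ¬ IsSquare W.Δ →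
      W.analyticRank = 0 → BSDp W 2 →
      ∀ i : AlgebraicClosure ℚ, i ^ 2 = -1 →
      ∀ κL : ZpExtension ↥(W.divisionField 2 ⊔ IntermediateField.adjoin ℚ {i}) 2,
        κL.IsCyclotomic → ClassicalMuVanishes κL := by
  intro W _ _ _ hord ht hsq _ _ i hi κL hκL
  set B : IntermediateField ℚ (AlgebraicClosure ℚ) := ℚ⟮xT W two_ne_zero 0⟯ with hB
  haveI : FiniteDimensional ℚ ↥B := adjoin.finiteDimensional ((AlgebraicClosure.isAlgebraic ℚ).isAlgebraic _).isIntegral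
  haveI : NumberField ↥B := NumberField.mk
  have h3 : Module.finrank ℚ ↥B = 3 := finrank_adjoin_xT_model W ht 0
  have h4mem : (4 : AlgebraicClosure ℚ) * xT W two_ne_zero 0 ∈ B := mul_mem (ofNat_mem B 4) (mem_adjoin_simple_self ℚ _)
  have he : aeval (⟨4 * xT W two_ne_zero 0, h4mem⟩ : ↥B) (twoDivisionUCubic W) = 0 :=
    aeval_mk_eq_zero_of_aeval_eq_zero W B (aeval_four_mul_xT_twoDivisionUCubic W 0) h4mem
  obtain ⟨hμ, D, hδ⟩ := hN ↥B h3 (not_isGalois_adjoin_xT W ht hsq 0) (nonempty_ringHom_padic_two_of_root W hord ht h3 he)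
    (even_padicValInt_two_discr_of_isOrdinaryAt W hord ht hsq h3 he)
  have hodd : Odd (Module.finrank ℚ ↥B) := by rw [h3]; decide
  have hP : ∀ κP : ZpExtension ↥(B ⊔ IntermediateField.adjoin ℚ ({i} : Set (AlgebraicClosure ℚ))) 2,
      κP.IsCyclotomic → ClassicalMuVanishes κP :=
    classicalMu_sup_adjoin_of_sq_eq_neg_one_of_narrowDefect_le B hodd hi hμ D hδ
  exact (classicalMuVanishes_sup_adjoin_I_iff_pointFieldCM_of_isOrdinaryAt W hord ht hsq hi 0).mpr hP κL hκL

end Stub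

end Summit.BirchSwinnertonDyer.BirchSwinnertonDyer.Theorems.AlignedTransportAtTwoCubicDiscriminantSquareClass

end
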